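import Summits.BirchSwinnertonDyer.Rank1Residual.X5.SelmerSolitaireQuadratic
import HarnessLib

/-!
# X5 · Selmer solitaire, quadratic layer — LEMMAS for the T3 normal form (coordinates of `qform`,
# `polar`, `lineOf`, `lamCoord`, `nfVec`; membership in `nfSpace`)

HONEST FRAMING (cell `b2b-bsdres`, run/shared/lean/b2b/bsd-rank1-residual/, verbatim in every
file): the goal of the cell is to DELETE the COMBINATION-SHAPED residual classes of the
Birch–Swinnerton-Dyer formula for ALL analytic-rank `≤ 1` elliptic curves over `ℚ` — "full BSD
formula for every rank `≤ 1` curve in class `C`" assembled STRICTLY from published theorems — so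
that the rank-`≤ 1` remainder becomes exactly the CONSTRUCTION-SHAPED classes, which are TYPED
(missing-input `Prop`s), NOT attempted. This is not "finishing BSD". O1 team (class X5, `p = 2`,
non-CM), ORDER v2.9 pool slot (ii‴) = lens-2 GEN 10's QUADRATIC-SPACE LAYER (o1 lead R-G20.3 /
R-G20.4), item **Q3**; pool hand = seat `b2b-bsdres-x11b3-p2` GEN 6 (x11b3 prover released to the o1
pool; yields to x11b3 deals). PURE `𝔽₂` LINEAR ALGEBRA about the vocabulary of
`X5/SelmerSolitaireQuadratic.lean` (x11b3-p4, p283641; spelling of record = lens-2's seat sketch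
`HOME/b2b-bsdres-o1-idea-2-g10/lean/O1Stub1QuadraticSketch.lean`): THEOREMS ONLY (no definition, no
named fact, no `sorry`); nothing arithmetic is asserted (the dictionary AR1–AR4 to Selmer groups is
NOT here); reach-neutral (R1 closes no class); nothing booked; O1 OPEN.

Companion of `X5/SelmerSolitaireQuadraticNormalForm.lean` (QS1 `normalForm_holds`, QS1u
`normalFormUnique_holds`), which imports this file. Contents (namespace `…Quadratic.NF`):
* §1 `qform` / `polar` split at `∞` (`qform_eq`, `polar_eq`), polarisation `qform_add`,
  `polar_eq_zero_of_mem` (the polar form vanishes on a totally singular subspace), the `𝔽₂²`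
  bookkeeping of the two singular lines `lineOf b`, `lineOf (!b)` and the coordinates `lamCoord`
  (every vector of `P̄₂` is `λ_b • lineOf b + λ_{!b} • lineOf (!b)`; `decide`-level facts);
* §2 the coordinates of T3's explicit vectors `nfVec P b ε z` (`t`-part `z`, `λ_b`-part `ε`,
  `λ′`-part `σ · z`), their linearity in `(ε, z)`, and **`mem_nfSpace_iff`**:
  `x ∈ nfSpace P b ↔ ∃ ε z, x = nfVec P b ε z` (the explicit vectors already form a subspace);
* §3 small `𝔽₂` / sum lemmas and the **kernel triviality** `eq_zero_of_snd_eq_zero_of_sum_eq_zero`: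
  in a totally singular `U` with `∅` core, a vector with zero `t`-coordinates whose two
  `∞`-coordinates have sum `0` is zero.

References: lens-2 GEN 5 (G5.2, T3) and GEN 10 (2G10.2 QS0–QS1); B. Mazur, K. Rubin, *Introduction to
Kolyvagin systems*, Contemp. Math. 358 (2004), §4.3 [cite: MazurRubin2004Intro, §4.3];
B. Poonen, E. Rains, JAMS 25 (2012) §4 [cite: PoonenRains2012, §4]. Folklore linear algebra.
-/

namespace Summit.BirchSwinnertonDyer.Rank1Residual.X5.SelmerSolitaire.Quadratic

open Finset SelmerSolitaire

namespace NF

variable {s : ℕ}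

/-! ### §1 Coordinate bookkeeping for `qform`, `polar`, `lineOf`, `lamCoord` -/

/-- `qform` split into the `∞`-term and the finite vertices. [folklore] -/
theorem qform_eq (x : QVec s) :
    qform x = (x none).1 * (x none).2 + ∑ i : Fin s, (x (some i)).1 * (x (some i)).2 := by
  unfold qform
  rw [Fintype.sum_option]

/-- `polar` split into the `∞`-term and the finite vertices. [folklore] -/
theorem polar_eq (x y : QVec s) :
    polar x y = ((x none).1 * (y none).2 + (x none).2 * (y none).1) +
      ∑ i : Fin s, ((x (some i)).1 * (y (some i)).2 + (x (some i)).2 * (y (some i)).1) := by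
  unfold polar
  rw [Fintype.sum_option]

/-- Polarisation: `q(x + y) = q x + q y + polar x y`. [folklore] -/
theorem qform_add (x y : QVec s) : qform (x + y) = qform x + qform y + polar x y := by
  simp only [qform, polar, Pi.add_apply, Prod.fst_add, Prod.snd_add, ← Finset.sum_add_distrib]
  refine Finset.sum_congr rfl fun v _ ↦ ?_
  ring

/-- On a totally singular subspace the polar form vanishes. [folklore] -/
theorem polar_eq_zero_of_mem {U : Submodule (ZMod 2) (QVec s)} (hq : ∀ x ∈ U, qform x = 0)
    {x y : QVec s} (hx : x ∈ U) (hy : y ∈ U) : polar x y = 0 := by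
  have h := qform_add x y
  rw [hq _ (U.add_mem hx hy), hq x hx, hq y hy, zero_add, zero_add] at h
  exact h.symm

/-- Every vector of `P̄₂ = 𝔽₂²` is `λ_b • lineOf b + λ_{!b} • lineOf (!b)`. [folklore] -/
theorem eq_lamCoord_smul_add (b : Bool) (q : ZMod 2 × ZMod 2) :
    q = lamCoord b q • lineOf b + lamCoord (!b) q • lineOf (!b) := by
  obtain ⟨q1, q2⟩ := q
  cases b <;> simp [lamCoord, lineOf]

/-- `lamCoord b` is additive. [folklore] -/
theorem lamCoord_add (b : Bool) (q q' : ZMod 2 × ZMod 2) :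
    lamCoord b (q + q') = lamCoord b q + lamCoord b q' := by
  cases b <;> simp [lamCoord]

/-- `lamCoord b (c • q) = c * lamCoord b q`. [folklore] -/
theorem lamCoord_smul (b : Bool) (c : ZMod 2) (q : ZMod 2 × ZMod 2) :
    lamCoord b (c • q) = c * lamCoord b q := by
  cases b <;> simp [lamCoord]

/-- `lamCoord b (lineOf b) = 1`, `lamCoord b (lineOf (!b)) = 0`. [folklore] -/
theorem lamCoord_lineOf (b : Bool) : lamCoord b (lineOf b) = 1 ∧ lamCoord b (lineOf (!b)) = 0 := by
  cases b <;> simp [lamCoord, lineOf]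

/-- `lamCoord (!b) (lineOf b) = 0`. [folklore] -/
theorem lamCoord_not_lineOf (b : Bool) : lamCoord (!b) (lineOf b) = 0 := by
  cases b <;> simp [lamCoord, lineOf]

/-- The two coordinates of `lineOf b` sum to `1`. [folklore] -/
theorem lineOf_fst_add_snd (b : Bool) : (lineOf b).1 + (lineOf b).2 = 1 := by
  cases b <;> simp [lineOf]

/-- The product of the two coordinates of a multiple of a singular line vanishes. [folklore] -/
theorem smul_lineOf_fst_mul_snd (b : Bool) (c : ZMod 2) : (c • lineOf b).1 * (c • lineOf b).2 = 0 := by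
  cases b <;> simp [lineOf]

/-- The polar form of two multiples of the same singular line vanishes. [folklore] -/
theorem polarInf_smul_lineOf_same (b : Bool) (c c' : ZMod 2) :
    (c • lineOf b).1 * (c' • lineOf b).2 + (c • lineOf b).2 * (c' • lineOf b).1 = 0 := by
  cases b <;> simp [lineOf]

/-- The polar form pairs the two singular lines to `1`: `polar_∞(lineOf b, c • lineOf (!b)) = c`.
[folklore] -/
theorem polarInf_lineOf_smul_not (b : Bool) (c : ZMod 2) :
    (lineOf b).1 * (c • lineOf (!b)).2 + (lineOf b).2 * (c • lineOf (!b)).1 = c := by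
  cases b <;> simp [lineOf]

/-- A vector of `𝔽₂²` with coordinate sum `1` is one of the two singular lines. [folklore] -/
theorem exists_eq_lineOf_of_fst_add_snd {q : ZMod 2 × ZMod 2} (h : q.1 + q.2 = 1) :
    ∃ b : Bool, q = lineOf b := by
  revert q
  decide

/-- In `ZMod 2`: `a + c = 0 ∧ a * c = 0 ⟹ a = 0 ∧ c = 0` — no, only `a = c` and `a·a = a`; used as:
coordinate sum `0` and coordinate product `0` force the zero vector. [folklore] -/
theorem eq_zero_of_fst_add_snd_of_fst_mul_snd {q : ZMod 2 × ZMod 2} (h1 : q.1 + q.2 = 0)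
    (h2 : q.1 * q.2 = 0) : q = 0 := by
  revert q
  decide

/-- `lineOf` is injective, even up to a scalar: `lineOf b = c • lineOf b' ⟹ b = b'`. [folklore] -/
theorem lineOf_eq_smul_lineOf {b b' : Bool} {c : ZMod 2} (h : lineOf b = c • lineOf b') : b = b' := by
  revert b b' c
  decide

/-- `c • lineOf b = c • lineOf (!b) ⟹ c = 0`. [folklore] -/
theorem smul_lineOf_eq_smul_lineOf_not {b : Bool} {c : ZMod 2} (h : c • lineOf b = c • lineOf (!b)) :
    c = 0 := by
  revert b c
  decide

/-! ### §2 Coordinates of `nfVec` and membership in `nfSpace` -/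

/-- The `t`-coordinates of `nfVec P b ε z` are `z`. [folklore] -/
theorem nfVec_some_snd (P : Position s) (b : Bool) (ε : ZMod 2) (z : Fin s → ZMod 2) (i : Fin s) :
    (nfVec P b ε z (some i)).2 = z i := rfl

/-- The `u`-coordinates of `nfVec P b ε z`. [folklore] -/
theorem nfVec_some_fst (P : Position s) (b : Bool) (ε : ZMod 2) (z : Fin s → ZMod 2) (i : Fin s) :
    (nfVec P b ε z (some i)).1 = (∑ l', P.S (some i) (some l') * z l') + ε * P.S (some i) none := rfl

/-- The `∞`-part of `nfVec P b ε z`. [folklore] -/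
theorem nfVec_none (P : Position s) (b : Bool) (ε : ZMod 2) (z : Fin s → ZMod 2) :
    nfVec P b ε z none = ε • lineOf b + (∑ l, P.S (some l) none * z l) • lineOf (!b) := rfl

/-- The `λ_b`-coordinate of `nfVec P b ε z` is `ε`. [folklore] -/
theorem lamCoord_nfVec_none (P : Position s) (b : Bool) (ε : ZMod 2) (z : Fin s → ZMod 2) :
    lamCoord b (nfVec P b ε z none) = ε := by
  rw [nfVec_none, lamCoord_add, lamCoord_smul, lamCoord_smul, (lamCoord_lineOf b).1,
    (lamCoord_lineOf b).2, mul_one, mul_zero, add_zero]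

/-- The `λ_{!b}`-coordinate of `nfVec P b ε z` is `σ · z`. [folklore] -/
theorem lamCoord_not_nfVec_none (P : Position s) (b : Bool) (ε : ZMod 2) (z : Fin s → ZMod 2) :
    lamCoord (!b) (nfVec P b ε z none) = ∑ l, P.S (some l) none * z l := by
  have h := lamCoord_lineOf (!b)
  rw [Bool.not_not] at h
  rw [nfVec_none, lamCoord_add, lamCoord_smul, lamCoord_smul, h.1, h.2, mul_one, mul_zero, zero_add]

/-- `nfVec` is additive in `(ε, z)`. [folklore] -/
theorem nfVec_add (P : Position s) (b : Bool) (ε ε' : ZMod 2) (z z' : Fin s → ZMod 2) :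
    nfVec P b ε z + nfVec P b ε' z' = nfVec P b (ε + ε') (z + z') := by
  funext v
  cases v with
  | none =>
    simp only [Pi.add_apply, nfVec_none, mul_add, Finset.sum_add_distrib, add_smul]
    abel
  | some l =>
    simp only [Pi.add_apply, nfVec, Prod.mk_add_mk, Pi.add_apply, mul_add, Finset.sum_add_distrib,
      add_mul]
    ring_nf

/-- `nfVec` is homogeneous in `(ε, z)`. [folklore] -/
theorem nfVec_smul (P : Position s) (b : Bool) (c ε : ZMod 2) (z : Fin s → ZMod 2) :
    c • nfVec P b ε z = nfVec P b (c * ε) (c • z) := by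
  funext v
  cases v with
  | none =>
    simp only [Pi.smul_apply, nfVec_none, smul_add, smul_smul, Finset.mul_sum, smul_eq_mul]
    congr 1
    congr 1
    refine Finset.sum_congr rfl fun l _ ↦ ?_
    ring
  | some l =>
    simp only [Pi.smul_apply, nfVec, Prod.smul_mk, smul_eq_mul, Finset.mul_sum, mul_add]
    congr 1
    · congr 1
      · refine Finset.sum_congr rfl fun l' _ ↦ ?_; ring
      · ring

/-- **Membership in `nfSpace`**: the explicit vectors already form a subspace, so
`x ∈ nfSpace P b ↔ ∃ ε z, x = nfVec P b ε z`. [folklore] -/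
theorem mem_nfSpace_iff (P : Position s) (b : Bool) (x : QVec s) :
    x ∈ nfSpace P b ↔ ∃ ε z, x = nfVec P b ε z := by
  constructor
  · intro hx
    induction hx using Submodule.span_induction with
    | mem y hy => exact hy
    | zero => exact ⟨0, 0, by rw [← zero_smul (ZMod 2) (nfVec P b 0 0), nfVec_smul, zero_mul, zero_smul]⟩
    | add y y' _ _ hy hy' =>
      obtain ⟨ε, z, rfl⟩ := hy
      obtain ⟨ε', z', rfl⟩ := hy'
      exact ⟨ε + ε', z + z', nfVec_add P b ε ε' z z'⟩
    | smul c y _ hy =>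
      obtain ⟨ε, z, rfl⟩ := hy
      exact ⟨c * ε, c • z, nfVec_smul P b c ε z⟩
  · rintro ⟨ε, z, rfl⟩
    exact Submodule.subset_span ⟨ε, z, rfl⟩

/-- The explicit vectors lie in `nfSpace`. [folklore] -/
theorem nfVec_mem_nfSpace (P : Position s) (b : Bool) (ε : ZMod 2) (z : Fin s → ZMod 2) :
    nfVec P b ε z ∈ nfSpace P b :=
  (mem_nfSpace_iff P b _).mpr ⟨ε, z, rfl⟩


/-! ### §3 Small `𝔽₂` facts, `δ`-sums and the kernel triviality -/

/-- In `𝔽₂`, `a + b = 0 ↔ a = b`. [folklore] -/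
theorem zmod2_add_eq_zero_iff {a b : ZMod 2} : a + b = 0 ↔ a = b := by revert a b; decide

/-- `lamCoord b` is compatible with subtraction. [folklore] -/
theorem lamCoord_sub (b : Bool) (q q' : ZMod 2 × ZMod 2) :
    lamCoord b (q - q') = lamCoord b q - lamCoord b q' := by
  cases b <;> simp [lamCoord]

/-- `∑_i f i · [i = ℓ] = f ℓ` over `Fin s`. [folklore] -/
theorem sum_mul_ite_eq (f : Fin s → ZMod 2) (ℓ : Fin s) :
    ∑ i : Fin s, f i * (if i = ℓ then 1 else 0) = f ℓ := by
  simp only [mul_ite, mul_one, mul_zero, Finset.sum_ite_eq', Finset.mem_univ, if_true]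

/-- `∑_i [i = ℓ] · f i = f ℓ` over `Fin s`. [folklore] -/
theorem sum_ite_mul_eq (f : Fin s → ZMod 2) (ℓ : Fin s) :
    ∑ i : Fin s, (if i = ℓ then 1 else 0) * f i = f ℓ := by
  simp only [ite_mul, one_mul, zero_mul, Finset.sum_ite_eq', Finset.mem_univ, if_true]

/-- For a vector with vanishing `t`-coordinates, `q(x) = x_∞.1 · x_∞.2`. [folklore] -/
theorem qform_eq_of_snd_eq_zero {x : QVec s} (ht : ∀ i, (x (some i)).2 = 0) :
    qform x = (x none).1 * (x none).2 := by
  rw [qform_eq, Finset.sum_eq_zero fun i _ ↦ by rw [ht i, mul_zero], add_zero]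

/-- **Kernel triviality.** In a totally singular `U` with `∅` core, a vector with zero
`t`-coordinates whose two `∞`-coordinates have sum `0` is zero (`q(x) = a·b` with `a = b` forces
`a = b = 0`, then `∅`-core). [folklore] -/
theorem eq_zero_of_snd_eq_zero_of_sum_eq_zero {U : Submodule (ZMod 2) (QVec s)}
    (hq : ∀ x ∈ U, qform x = 0) (hcore : CoreQ U ∅) {x : QVec s} (hx : x ∈ U)
    (ht : ∀ i, (x (some i)).2 = 0) (hsum : (x none).1 + (x none).2 = 0) : x = 0 := by
  have hqx := hq x hx
  rw [qform_eq_of_snd_eq_zero ht] at hqx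
  have hnone : x none = 0 := eq_zero_of_fst_add_snd_of_fst_mul_snd hsum hqx
  exact hcore x hx ⟨hnone, fun i ↦ ⟨fun h ↦ absurd h (Finset.notMem_empty i), fun _ ↦ ht i⟩⟩

end NF

end Summit.BirchSwinnertonDyer.Rank1Residual.X5.SelmerSolitaire.Quadratic
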